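import Literature.NumberTheory.Rogawski1990.ArchBouazizSpace                 -- ★ p849634 (LH3-p01 (g3)): `IsIndefiniteAt`, `IsCoveredWall`, `AgreesOnCovered` (+ ★ (COORD) `RegS`∕`RegG`∕`archRH`∕`archRG`)
import Literature.NumberTheory.Automorphic.ArchInnerFormCartanAtlas           -- ★ p849656 (LH3-p03 (g2)): `formSign`, `lineOf` (via PART 2a), `splitChartPlaces`, `gprimeTorus`
import Literature.NumberTheory.Automorphic.ArchEndoscopicCartanAtlas          -- ★ p849525 (LH3-p03 (g2)): `endoTorus`
import Literature.NumberTheory.Automorphic.ArchCartanWallExtension            -- ★ p849689 (LH3-p01 (g3)): `extendFrom_apply_homeomorph`, the ★ `bzExtend` pattern (here re-cut with `RegG` as the literal set)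
import Literature.NumberTheory.Rogawski1990.ArchExplicitTransferFactor        -- ★ `archExplicitDelta` = print's `Δ″_∞`
import HarnessLib

/-!
# `transfFam` — the CANDIDATE `H`-side family «Transf_{Δ″}(F)» attached to a `G′`-side Cartan family `F`: the `Δ″_∞`-weighted partner sum, normalised by Shelstad's
# `R_T`, extended across the real walls (Rogawski 1990 §4.3 (4.3.1) p. 43, §14.3 pp. 233–234; Bouaziz 1994 Rem. 2 p. 594 «Transf»; Shelstad 1979 §4 pp. 22–23)

Topic `NumberTheory/Rogawski1990`; namespace `Literature.NumberTheory.Rogawski1990`.  Definitions WITH BODIES + theorems (no instance, no notation, no axiom, no named fact, no `sorry`).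
Cell `pub/hodgecm-mathlib`, line LH3 (closer stub `stub_N9` — archimedean endoscopic transfer — of `Cruxes/H413/Lines/F0_U3LettersRung1.lean`, crux H413 = `stmt-HodgeConjecture-24833`):
organ **(TRANSF-DEF)** of the direct road (LH3-plan (g2) PACK-SPEC v1 §2 ∕ DEAL 2026-09-02T06:03:06Z; author LH7-p02 (g2)) — the TERM the pay-down skeleton `F0_P3c_StubN9Direct` puts in
its section variable `transfFam` (organs O-L2 «Transf»: `AgreesOnCovered → ArchHCSpaceG … jc′ F → ArchBouazizSpaceH jcH (transfFam L α μ F)` and O-READ).  Everything is over the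
DIAGONAL frame `G′_∞ = U(diag α)(L⁺ ⊗ ℝ)` and the common coordinates `c : W → Fin 3 → ℝ` of ★ (COORD) (`W` = the complex places of `L`).

THE MATHEMATICS.  (4.3.1)∕§14.3: `Φ^st(γ_H, f^H) = Σ_{[γ′] ↔ γ_H} Δ″_∞(γ_H, γ′) Φ([γ′], a′)`.  Read on the Cartan charts: for the `H`-chart `S` (split at `w ∈ S`) at a regular point `c`,
`γ_H = endoTorus L S c` (★ atlas); its partners in `G′_∞` lie on the `G′`-chart `gprimeTorus L α S` of the SAME label at the slot-permuted coordinates `slotPerm ρ c`, `ρ` ranging over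
the per-place slot permutations `partnerPerms S` (all of `S₃` at a compact place `w ∉ S`, the identity at a split place; the permutations NOT giving a partner are killed by `Δ″`
itself, ★ `archExplicitDelta_of_not_isArchNormPair`, so no case analysis enters the definition); each partner CLASS is hit `2` times at an indefinite compact place (the even-slot swap
realises the same class: compact Weyl group of `U(2,1)` ≅ `S₂`) and `6` times at a definite one (`U(3)`: all of `S₃`), once at a split place — whence `partnerWeight` (these counts are
THEOREMS of (PARTNER)∕(EXH), LH3-p03; the definition does not wait for them).  Un-normalising the `G′`-family (`F S′ = R′_{S′} · Φ`, ★ `archRG`) and normalising on `H` (★ `archRH`):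
`transfFamReg L α μ F S c := archRH S c · partnerWeight L α S · Σ_{ρ ∈ partnerPerms S} Δ″_∞(endoTorus L S c, gprimeTorus L α S (slotPerm ρ c)) · F S (slotPerm ρ c) ∕ archRG S (slotPerm ρ c)`,
and the family member is its extension FROM THE `G`-REGULAR SET (`bzExtendG`, = ★ `bzExtend` with `RegG` as the literal set; PACK-SPEC §2 «defined on `RegG S` by the partner sum and
extended by `extendFrom`»): literally the partner sum on `RegG S`, its `RegG`-limit on the `G`-walls inside `H_reg` (where `D_{G∕H,∞} = 0` kills the literal sum while (4.3.1) defines the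
transfer's orbital integrals by continuity) and on the real walls `x_w = 0`, `0` outside `InRegS S`: **`transfFam L α μ F S := bzExtendG S (transfFamReg L α μ F S)`**.  The slot sign pattern `slotSign L α w k = sgn re σ_w(α_{lineOf k})` (sign of the line sitting in chart slot `k`,
★ `lineOf`: slots `0, 1` even, slot `2` odd at an indefinite place) feeds ★ `IsIndefiniteAt`∕`AgreesOnCovered`; `AgreesOnCoveredSlots` instantiates the junction of the two jump-constant
systems ON SLOTS (`jcH S w = 2 · jc′ S w 0 2` at covered walls, PACK-SPEC §3).

WHAT IS TYPED ∕ PROVED.  §1 `slotSign`, `AgreesOnCoveredSlots` (abbrev); §2 `slotPerm`, `partnerPerms`, `partnerWeight` + `slotPerm_one`, `slotPerm_mul`, `mem_partnerPerms_iff`,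
`one_mem_partnerPerms`, `eq_one_of_mem_partnerPerms`, `slotPerm_apply_of_mem`, `slotPerm_mem_regG_iff` (`RegG` is stable under the partner permutations); §2b `bzExtendG` + its API and
TRANSPORT PRINCIPLE `bzExtendG_apply_homeomorph` (★ `bzExtend`'s, with `RegG`); §3 `transfFamReg`, **`transfFam`** (signature = the skeleton's token target) + `transfFamReg_zero`,
`transfFam_zero_of_mem_regG`, `transfFam_eqOn_regG`, `transfFam_of_mem_inRegS_of_not_mem_regG`, `transfFam_of_not_mem_inRegS`, `transfFamReg_congr_of_forall`, **`transfFamReg_congr`** (STATED TRUE: agreement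
of `F S`, `F′ S` on `RegG S` gives agreement of the two `transfFamReg` on `RegG S` — the partner points of a `G`-regular point are `G`-regular; on `RegS ∖ RegG` it fails in general).
NOT HERE: the vanishing `transfFamReg … S = 0` on `RegS S` for `S ⊄ splitChartPlaces L α` (a split `H`-place that is definite for `G′` has no partner, ★ `not_isArchNormPair_of_posDef_place`
— ED. 2, with the frame hypotheses it needs); (M2)∕O-L2 (that `transfFam` of an HC family is a Bouaziz family) and O-READ — organs, not definitions.
HONEST LABEL: HC_CM is proved only modulo the 7 printed citations (2 remaining: hLiu418 = stmt-HodgeConjecture-24832, h413 = stmt-HodgeConjecture-24833) until rung 0 closes; count-neutral.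

## References
* [Rogawski1990] J. D. Rogawski, *Automorphic Representations of Unitary Groups in Three Variables*, Ann. of Math. Stud. 123 (1990), §4.3 (4.3.1) p. 43, §14.3 pp. 233–234, §3.6 p. 31,
  §14.2 p. 232.
* [Bouaziz1994IntegralesOrbitales] A. Bouaziz, *Intégrales orbitales sur les groupes de Lie réductifs*, Ann. Sci. ÉNS 27 (1994), Rem. 2 p. 594 («Transf»), §3.1 p. 579.
* [Shelstad1979] D. Shelstad, *Characters and inner forms of a quasi-split group over ℝ*, Compositio Math. 39 (1979), §4 pp. 22–23 (`R_T`, `Ψ^T_f`), Lemma 4.2 p. 23.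
-/

set_option autoImplicit false

noncomputable section

open NumberField NumberField.InfinitePlace Matrix Complex Set Finset Filter Topology
open scoped MatrixGroups Matrix Classical
open Literature.NumberTheory.Automorphic Literature.NumberTheory.Automorphic.UnitaryGroup Literature.NumberTheory.Automorphic.ArchCartan
open Literature.NumberTheory.GaloisRepresentations

namespace Literature.NumberTheory.Rogawski1990

/-! ## §1 The slot sign pattern of the diagonal frame; the junction of jump constants on slots -/

section SlotSign

variable (L : Type) [Field L] (α : Fin 3 → L)

/-- **`slotSign L α w k`** — the sign of the line sitting in chart slot `k` at the place `w`: `sgn re σ_w(α_{lineOf k})` (★ `formSign`, ★ `lineOf`: slot `0` = first even line, slot `1` =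
second even line, slot `2` = odd line; so at an indefinite place `slotSign w 0 = slotSign w 1 ≠ slotSign w 2`).  The `s` of ★ (COORD) `InRegG s` ∕ ★ `IsIndefiniteAt s` in SLOT order.
[cite: Rogawski1990, §3.6 p. 31; §14.2 p. 232] -/
def slotSign : {w : InfinitePlace L // IsComplex w} → Fin 3 → SignType :=
  fun w k => formSign L α w (lineOf (formSign L α w) k)

/-- Unfolding of `slotSign`. [cite: Rogawski1990, §3.6 p. 31] -/
theorem slotSign_apply (w : {w : InfinitePlace L // IsComplex w}) (k : Fin 3) : slotSign L α w k = formSign L α w (lineOf (formSign L α w) k) := rfl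

/-- **`AgreesOnCoveredSlots L α jc′ jcH`** — ★ `AgreesOnCovered` ON SLOTS: at every covered wall (compact `H`-place `w ∉ S`, indefinite for `diag α`) the `H`-side jump constant is
`jcH S w = 2 · jc′ S w 0 2` — the `G′`-side constant of the `(0, 2)` slot wall (the noncompact Cayley wall of the compact chart), doubled (PACK-SPEC §3: `d = 1` on both sides, the two
equal-`κ` partner classes add). [cite: Shelstad1979, Thm. 4.7 (IIIb) (p. 31)] [cite: Bouaziz1994IntegralesOrbitales, Rem. 2 p. 594] -/
abbrev AgreesOnCoveredSlots (jc' : Finset {w : InfinitePlace L // IsComplex w} → {w : InfinitePlace L // IsComplex w} → Fin 3 → Fin 3 → ℂ)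
    (jcH : Finset {w : InfinitePlace L // IsComplex w} → {w : InfinitePlace L // IsComplex w} → ℂ) : Prop :=
  AgreesOnCovered (slotSign L α) (fun _ => 0) (fun _ => 2) jc' jcH

/-- Unfolding of `AgreesOnCoveredSlots`: `jcH S w = 2 · jc′ S w 0 2` at every covered wall. [cite: Shelstad1979, Thm. 4.7 (IIIb) (p. 31)] -/
theorem agreesOnCoveredSlots_iff (jc' : Finset {w : InfinitePlace L // IsComplex w} → {w : InfinitePlace L // IsComplex w} → Fin 3 → Fin 3 → ℂ)
    (jcH : Finset {w : InfinitePlace L // IsComplex w} → {w : InfinitePlace L // IsComplex w} → ℂ) :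
    AgreesOnCoveredSlots L α jc' jcH ↔
      ∀ (S : Finset {w : InfinitePlace L // IsComplex w}) (w : {w : InfinitePlace L // IsComplex w}), IsCoveredWall (slotSign L α) S w → jcH S w = 2 * jc' S w 0 2 :=
  agreesOnCovered_iff _ _ _ _ _

end SlotSign

/-! ## §2 Slot permutations, the partner index set, the class weights -/

section Partners

variable {W : Type*}

/-- **`slotPerm ρ c`** — the coordinates re-labelled place by place by the slot permutations `ρ w ∈ S₃`: `(slotPerm ρ c) w i = c w (ρ w i)` (the partners of an `H`-chart point on the
`G′`-chart of the same label sit at permuted slots). [cite: Shelstad1979, Lemma 4.2 (p. 23)] [cite: Rogawski1990, §4.3 p. 43] -/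
def slotPerm (ρ : W → Equiv.Perm (Fin 3)) (c : W → Fin 3 → ℝ) : W → Fin 3 → ℝ :=
  fun w i => c w (ρ w i)

/-- Unfolding of `slotPerm`. [cite: Shelstad1979, Lemma 4.2 (p. 23)] -/
@[simp] theorem slotPerm_apply (ρ : W → Equiv.Perm (Fin 3)) (c : W → Fin 3 → ℝ) (w : W) (i : Fin 3) : slotPerm ρ c w i = c w (ρ w i) := rfl

/-- The identity re-labelling. [cite: Shelstad1979, Lemma 4.2 (p. 23)] -/
@[simp] theorem slotPerm_one (c : W → Fin 3 → ℝ) : slotPerm (1 : W → Equiv.Perm (Fin 3)) c = c := rfl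

/-- Re-labelling is a right action: `slotPerm (ρ * τ) c = slotPerm τ (slotPerm ρ c)`. [cite: Shelstad1979, Lemma 4.2 (p. 23)] -/
theorem slotPerm_mul (ρ τ : W → Equiv.Perm (Fin 3)) (c : W → Fin 3 → ℝ) : slotPerm (ρ * τ) c = slotPerm τ (slotPerm ρ c) := rfl

/-- At a place where `ρ w = 1` the coordinates are unchanged. [cite: Shelstad1979, Lemma 4.2 (p. 23)] -/
theorem slotPerm_apply_of_eq_one {ρ : W → Equiv.Perm (Fin 3)} {w : W} (h : ρ w = 1) (c : W → Fin 3 → ℝ) : slotPerm ρ c w = c w := by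
  funext i
  rw [slotPerm_apply, h, Equiv.Perm.coe_one, id]

variable [Fintype W] [DecidableEq W]

/-- **`partnerPerms S`** — the per-place slot permutations indexing the partner terms of the `H`-chart `S`: ALL of `S₃` at a compact place `w ∉ S`, the identity at a split place `w ∈ S`
(Mathlib `Fintype.piFinset`).  Permutations not giving a norm partner contribute `0` through `Δ″` (★ `archExplicitDelta_of_not_isArchNormPair`).
[cite: Shelstad1979, Lemma 4.2 (p. 23)] [cite: Rogawski1990, §4.3 p. 43] -/
def partnerPerms (S : Finset W) : Finset (W → Equiv.Perm (Fin 3)) :=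
  Fintype.piFinset fun w => if w ∈ S then {1} else univ

/-- Membership in `partnerPerms S`: identity at the split places, anything at the compact ones. [cite: Shelstad1979, Lemma 4.2 (p. 23)] -/
theorem mem_partnerPerms_iff (S : Finset W) (ρ : W → Equiv.Perm (Fin 3)) : ρ ∈ partnerPerms S ↔ ∀ w, w ∈ S → ρ w = 1 := by
  rw [partnerPerms, Fintype.mem_piFinset]
  refine ⟨fun h w hw => ?_, fun h w => ?_⟩
  · have h1 := h w
    rw [if_pos hw, Finset.mem_singleton] at h1
    exact h1
  · by_cases hw : w ∈ S
    · rw [if_pos hw, Finset.mem_singleton]; exact h w hw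
    · rw [if_neg hw]; exact Finset.mem_univ _

/-- The identity is a partner permutation (the `H`-chart point itself is the first partner term). [cite: Shelstad1979, Lemma 4.2 (p. 23)] -/
theorem one_mem_partnerPerms (S : Finset W) : (1 : W → Equiv.Perm (Fin 3)) ∈ partnerPerms S :=
  (mem_partnerPerms_iff S 1).2 fun _ _ => rfl

/-- A partner permutation is the identity at every split place. [cite: Shelstad1979, Lemma 4.2 (p. 23)] -/
theorem eq_one_of_mem_partnerPerms {S : Finset W} {ρ : W → Equiv.Perm (Fin 3)} (h : ρ ∈ partnerPerms S) {w : W} (hw : w ∈ S) : ρ w = 1 :=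
  (mem_partnerPerms_iff S ρ).1 h w hw

/-- A partner permutation does not move the coordinates at a split place. [cite: Shelstad1979, Lemma 4.2 (p. 23)] -/
theorem slotPerm_apply_of_mem {S : Finset W} {ρ : W → Equiv.Perm (Fin 3)} (h : ρ ∈ partnerPerms S) {w : W} (hw : w ∈ S) (c : W → Fin 3 → ℝ) : slotPerm ρ c w = c w :=
  slotPerm_apply_of_eq_one (eq_one_of_mem_partnerPerms h hw) c

/-- **`RegG S` is stable under the partner permutations**: `slotPerm ρ c ∈ RegG S ↔ c ∈ RegG S` for `ρ ∈ partnerPerms S` (injectivity of `i ↦ e^{i c w i}` is permutation-invariant at the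
compact places; the split places are not moved). [cite: Bouaziz1994IntegralesOrbitales, §3.1 p. 579] [cite: Shelstad1979, Lemma 4.2 (p. 23)] -/
theorem slotPerm_mem_regG_iff {S : Finset W} {ρ : W → Equiv.Perm (Fin 3)} (h : ρ ∈ partnerPerms S) (c : W → Fin 3 → ℝ) : slotPerm ρ c ∈ RegG S ↔ c ∈ RegG S := by
  rw [mem_regG_iff, mem_regG_iff]
  refine and_congr (forall_congr' fun w => forall_congr' fun _ => ?_) (forall_congr' fun w => forall_congr' fun hw => by rw [slotPerm_apply_of_mem h hw])
  show (Function.Injective fun i : Fin 3 => Circle.exp (c w (ρ w i))) ↔ Function.Injective fun i : Fin 3 => Circle.exp (c w i)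
  exact ⟨fun hinj => fun i j hij => (ρ w).symm.injective (hinj (by simpa using hij)), fun hinj => hinj.comp (ρ w).injective⟩

end Partners

section Weights

variable (L : Type) [Field L] [NumberField L] (α : Fin 3 → L)

/-- **`partnerWeight L α S`** — the class-count correction of the partner sum: each `G′`-class stably conjugate to a regular point of the `H`-chart `S` is hit `2` times by `partnerPerms S`
at an indefinite compact place (the even-slot swap realises the same class — the compact Weyl group of `U(2,1)` on its compact Cartan is `S₂`), `6` times at a definite place (`U(3)`: all of
`S₃` realised), once at a split place; so `partnerWeight = ∏_{w ∉ S} (2 or 6)⁻¹` turns `Σ_ρ` into print's `Σ_{[γ′]}` over CLASSES (the counts are theorems of the atlas (PARTNER)∕(EXH); the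
definition does not wait for them). [cite: Rogawski1990, §4.3 (4.3.1) p. 43; §14.2 p. 232] [cite: Shelstad1979, Lemma 4.2 (p. 23)] -/
def partnerWeight (S : Finset {w : InfinitePlace L // IsComplex w}) : ℂ :=
  ∏ w ∈ univ \ S, (if IsIndefiniteAt (slotSign L α) w then (2 : ℂ) else 6)⁻¹

/-- The weight is non-zero. [cite: Rogawski1990, §4.3 p. 43] -/
theorem partnerWeight_ne_zero (S : Finset {w : InfinitePlace L // IsComplex w}) : partnerWeight L α S ≠ 0 := by
  refine Finset.prod_ne_zero_iff.2 fun w _ => inv_ne_zero ?_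
  split_ifs <;> norm_num

end Weights

/-! ## §2b Extension from the `G`-REGULAR set (PACK-SPEC §2: «defined on `RegG S` by the partner sum and extended by `extendFrom`») -/

section ExtendG

variable {W : Type*} [Fintype W] [DecidableEq W]

/-- **`bzExtendG S g`** — ★ `bzExtend` with the `G`-REGULAR set as the literal set: LITERALLY `g c` on `RegG S`; on `InRegS S ∖ RegG S` — the `G`-walls inside `H_reg` (where `D_{G∕H,∞}`
vanishes and (4.3.1) defines the transfer's orbital integrals BY CONTINUITY, Prop. 4.9.1 (a) «for all `G`-regular `γ` in `H`») and the real walls `x_w = 0` — the extension of `g` from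
`RegG S` (Mathlib `extendFrom`; existence of the limit is the organs' claim (M2), not assumed); `0` outside Bouaziz's `T_{in-reg} = InRegS S`.
[cite: Rogawski1990, §4.9 Prop. 4.9.1 (a) p. 55; §4.3 (4.3.1) p. 43] [cite: Bouaziz1994IntegralesOrbitales, §3.1 p. 579; §6.2 p. 591] -/
def bzExtendG (S : Finset W) (g : (W → Fin 3 → ℝ) → ℂ) : (W → Fin 3 → ℝ) → ℂ :=
  fun c => if c ∈ RegG S then g c else (InRegS S).indicator (extendFrom (RegG S) g) c

omit [Fintype W] [DecidableEq W] in
/-- **On the `G`-regular set the extension IS `g`, literally.** [cite: Bouaziz1994IntegralesOrbitales, §3.1 p. 579] -/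
theorem bzExtendG_of_mem_regG (S : Finset W) (g : (W → Fin 3 → ℝ) → ℂ) {c : W → Fin 3 → ℝ} (hc : c ∈ RegG S) : bzExtendG S g c = g c := by
  unfold bzExtendG
  rw [if_pos hc]

omit [Fintype W] [DecidableEq W] in
/-- `bzExtendG S g` and `g` agree on `RegG S`. [cite: Bouaziz1994IntegralesOrbitales, §3.1 p. 579] -/
theorem bzExtendG_eqOn_regG (S : Finset W) (g : (W → Fin 3 → ℝ) → ℂ) : EqOn (bzExtendG S g) g (RegG S) :=
  fun _ hc => bzExtendG_of_mem_regG S g hc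

omit [Fintype W] [DecidableEq W] in
/-- On `InRegS S` off `RegG S` (the `G`-walls inside `H_reg` and the real walls) the value is the extension `extendFrom (RegG S) g`.
[cite: Rogawski1990, §4.9 Prop. 4.9.1 (a) p. 55] [cite: Bouaziz1994IntegralesOrbitales, §3.1 p. 579] -/
theorem bzExtendG_of_mem_inRegS_of_not_mem_regG (S : Finset W) (g : (W → Fin 3 → ℝ) → ℂ) {c : W → Fin 3 → ℝ} (h1 : c ∈ InRegS S) (h2 : c ∉ RegG S) :
    bzExtendG S g c = extendFrom (RegG S) g c := by
  unfold bzExtendG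
  rw [if_neg h2, Set.indicator_of_mem h1]

omit [Fintype W] [DecidableEq W] in
/-- Off `InRegS S` (the imaginary walls) the value is `0`. [cite: Bouaziz1994IntegralesOrbitales, §6.2 p. 591] -/
theorem bzExtendG_of_not_mem_inRegS (S : Finset W) (g : (W → Fin 3 → ℝ) → ℂ) {c : W → Fin 3 → ℝ} (h : c ∉ InRegS S) : bzExtendG S g c = 0 := by
  unfold bzExtendG
  rw [if_neg (fun h' => h (regS_subset_inRegS S (regG_subset_regS S h'))), Set.indicator_of_notMem h]

omit [Fintype W] [DecidableEq W] in
/-- **TRANSPORT PRINCIPLE** (★ `bzExtend_apply_homeomorph` with `RegG`): a homeomorphism of the coordinate space preserving `RegG S`, `InRegS S` and `g` on `RegG S` preserves `bzExtendG S g`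
at EVERY point (no limit needs to exist: ★ `extendFrom_apply_homeomorph`). [cite: Bouaziz1994IntegralesOrbitales, §3.1 p. 579] [cite: Shelstad1979, §4 p. 22] -/
theorem bzExtendG_apply_homeomorph (S : Finset W) (g : (W → Fin 3 → ℝ) → ℂ) (φ : (W → Fin 3 → ℝ) ≃ₜ (W → Fin 3 → ℝ))
    (hR : ∀ x, φ x ∈ RegG S ↔ x ∈ RegG S) (hI : ∀ x, φ x ∈ InRegS S ↔ x ∈ InRegS S) (hg : ∀ a ∈ RegG S, g (φ a) = g a) (c : W → Fin 3 → ℝ) :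
    bzExtendG S g (φ c) = bzExtendG S g c := by
  by_cases hcr : c ∈ RegG S
  · rw [bzExtendG_of_mem_regG S g hcr, bzExtendG_of_mem_regG S g ((hR c).2 hcr), hg c hcr]
  · by_cases hc : c ∈ InRegS S
    · rw [bzExtendG_of_mem_inRegS_of_not_mem_regG S g hc hcr,
        bzExtendG_of_mem_inRegS_of_not_mem_regG S g ((hI c).2 hc) (fun h => hcr ((hR c).1 h))]
      exact extendFrom_apply_homeomorph φ hR hg c
    · rw [bzExtendG_of_not_mem_inRegS S g hc, bzExtendG_of_not_mem_inRegS S g (fun h => hc ((hI c).1 h))]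

end ExtendG

/-! ## §3 The candidate transfer family -/

section Transf

variable (L : Type) [Field L] [NumberField L] [IsCMField L] (α : Fin 3 → L) (μ : HeckeCharacter L)

/-- **`transfFamReg L α μ F S c`** — the `Δ″_∞`-weighted partner sum on the REGULAR set of the `H`-chart `S` (4.3.1)∕§14.3 read in the Cartan charts: `γ_H = endoTorus L S c` (★ atlas), the
candidate partners `gprimeTorus L α S (slotPerm ρ c)`, `ρ ∈ partnerPerms S` (★ `G′`-atlas of the SAME label at permuted slots; non-partners are killed by `Δ″` itself), the `G′`-family
un-normalised by ★ `archRG` (Shelstad's `R′`), the result normalised by ★ `archRH`, with the class-count weight `partnerWeight`: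
`R_S(c) · w_S · Σ_ρ Δ″_∞(endoTorus S c, gprimeTorus S (ρ·c)) · F S (ρ·c) ∕ R′_S(ρ·c)`.  (Values are READ only on `RegS S`; there `archRG S (ρ·c) ≠ 0` on the partner terms that survive.)
[cite: Rogawski1990, §4.3 (4.3.1) p. 43; §14.3 pp. 233–234] [cite: Shelstad1979, §4 pp. 22–23] [cite: Bouaziz1994IntegralesOrbitales, Rem. 2 p. 594] -/
def transfFamReg (F : Finset {w : InfinitePlace L // IsComplex w} → ({w : InfinitePlace L // IsComplex w} → Fin 3 → ℝ) → ℂ)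
    (S : Finset {w : InfinitePlace L // IsComplex w}) (c : {w : InfinitePlace L // IsComplex w} → Fin 3 → ℝ) : ℂ :=
  archRH S c * partnerWeight L α S *
    ∑ ρ ∈ partnerPerms S, archExplicitDelta L (Matrix.diagonal α) (endoTorus L S c) μ (gprimeTorus L α S (slotPerm ρ c)) * (F S (slotPerm ρ c) / archRG S (slotPerm ρ c))

/-- **`transfFam L α μ F`** — THE CANDIDATE `H`-SIDE FAMILY «`Transf_{Δ″}(F)`» (the skeleton's token): on each `H`-chart `S` the `bzExtendG` of `transfFamReg L α μ F S` — literally the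
`Δ″`-weighted partner sum on the `G`-regular set `RegG S`, its limit from `RegG S` on the `G`-walls inside `H_reg` and on the real walls `x_w = 0` (Harish-Chandra's `F^A(1)`; (M2)'s content
is that this extension is smooth on `InRegS S`), `0` outside Bouaziz's `T_{in-reg}` (PACK-SPEC §2).  O-L2 «Transf» asserts `ArchHCSpaceG … jc′ F → ArchBouazizSpaceH jcH (transfFam L α μ F)` under ★ `AgreesOnCovered`; O-READ reads it
back against the stable orbital family of a transfer. [cite: Bouaziz1994IntegralesOrbitales, Rem. 2 p. 594; §3.1 p. 579] [cite: Rogawski1990, §4.3 (4.3.1) p. 43; §14.3 pp. 233–234] -/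
def transfFam (F : Finset {w : InfinitePlace L // IsComplex w} → ({w : InfinitePlace L // IsComplex w} → Fin 3 → ℝ) → ℂ) :
    Finset {w : InfinitePlace L // IsComplex w} → ({w : InfinitePlace L // IsComplex w} → Fin 3 → ℝ) → ℂ :=
  fun S => bzExtendG S (transfFamReg L α μ F S)

variable (F F' : Finset {w : InfinitePlace L // IsComplex w} → ({w : InfinitePlace L // IsComplex w} → Fin 3 → ℝ) → ℂ) (S : Finset {w : InfinitePlace L // IsComplex w})

/-- Unfolding of `transfFam` on a chart. [cite: Bouaziz1994IntegralesOrbitales, Rem. 2 p. 594] -/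
theorem transfFam_apply : transfFam L α μ F S = bzExtendG S (transfFamReg L α μ F S) := rfl

/-- **On the `G`-regular set the family member IS the partner sum, literally** (`bzExtendG_eqOn_regG`). [cite: Bouaziz1994IntegralesOrbitales, §3.1 p. 579] [cite: Rogawski1990, §4.3 (4.3.1) p. 43] -/
theorem transfFam_eqOn_regG : EqOn (transfFam L α μ F S) (transfFamReg L α μ F S) (RegG S) :=
  bzExtendG_eqOn_regG S _

/-- `transfFam … F S c = transfFamReg … F S c` at a `G`-regular point. [cite: Rogawski1990, §4.3 (4.3.1) p. 43] -/
theorem transfFam_of_mem_regG {c : {w : InfinitePlace L // IsComplex w} → Fin 3 → ℝ} (hc : c ∈ RegG S) : transfFam L α μ F S c = transfFamReg L α μ F S c :=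
  bzExtendG_of_mem_regG S _ hc

/-- On the `G`-walls inside `H_reg` and on the real walls the family member is the extension from `RegG S`. [cite: Rogawski1990, §4.9 Prop. 4.9.1 (a) p. 55] -/
theorem transfFam_of_mem_inRegS_of_not_mem_regG {c : {w : InfinitePlace L // IsComplex w} → Fin 3 → ℝ} (h1 : c ∈ InRegS S) (h2 : c ∉ RegG S) :
    transfFam L α μ F S c = extendFrom (RegG S) (transfFamReg L α μ F S) c :=
  bzExtendG_of_mem_inRegS_of_not_mem_regG S _ h1 h2

/-- Off `InRegS S` the family member is `0`. [cite: Bouaziz1994IntegralesOrbitales, §6.2 p. 591] -/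
theorem transfFam_of_not_mem_inRegS {c : {w : InfinitePlace L // IsComplex w} → Fin 3 → ℝ} (h : c ∉ InRegS S) : transfFam L α μ F S c = 0 :=
  bzExtendG_of_not_mem_inRegS S _ h

/-- The partner sum of the ZERO family vanishes. [cite: Rogawski1990, §4.3 (4.3.1) p. 43] -/
@[simp] theorem transfFamReg_zero : transfFamReg L α μ (fun _ _ => 0) S = fun _ => 0 := by
  funext c
  simp [transfFamReg]

/-- The transform of the zero family vanishes at every `G`-regular point. [cite: Bouaziz1994IntegralesOrbitales, §3.1 p. 579] -/
theorem transfFam_zero_of_mem_regG {c : {w : InfinitePlace L // IsComplex w} → Fin 3 → ℝ} (hc : c ∈ RegG S) : transfFam L α μ (fun _ _ => 0) S c = 0 := by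
  rw [transfFam_of_mem_regG L α μ _ S hc, transfFamReg_zero]

/-- **Pointwise congruence**: the partner sum at `c` reads `F S` only at the partner points `slotPerm ρ c`, `ρ ∈ partnerPerms S`. [cite: Rogawski1990, §4.3 (4.3.1) p. 43] -/
theorem transfFamReg_congr_of_forall {c : {w : InfinitePlace L // IsComplex w} → Fin 3 → ℝ} (h : ∀ ρ ∈ partnerPerms S, F S (slotPerm ρ c) = F' S (slotPerm ρ c)) :
    transfFamReg L α μ F S c = transfFamReg L α μ F' S c := by
  unfold transfFamReg
  congr 1
  exact Finset.sum_congr rfl fun ρ hρ => by rw [h ρ hρ]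

/-- **`transfFamReg_congr` — STATED TRUE: agreement on the `G`-REGULAR set is what propagates.**  If `F S` and `F′ S` agree on `RegG S`, the two partner sums agree on `RegG S` (the partner points
of a `G`-regular point are `G`-regular, `slotPerm_mem_regG_iff`).  On `RegS S ∖ RegG S` (the `G`-walls inside `H_reg`) the partner points leave `RegG S` too, so agreement on `RegG S` says
nothing there — that boundary behaviour is (M2)'s business, not a congruence lemma's. [cite: Rogawski1990, §4.3 (4.3.1) p. 43] [cite: Bouaziz1994IntegralesOrbitales, §3.1 p. 579] -/
theorem transfFamReg_congr (h : EqOn (F S) (F' S) (RegG S)) : EqOn (transfFamReg L α μ F S) (transfFamReg L α μ F' S) (RegG S) := fun c hc =>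
  transfFamReg_congr_of_forall L α μ F F' S fun _ hρ => h ((slotPerm_mem_regG_iff hρ c).2 hc)

end Transf


/-! ## §4 (ED. 2, append-only) The junction of jump constants on ADMISSIBLE labels only (skeleton v2, LH3-plan (g2) 2026-09-02T06:47Z) -/

section Admissible

variable (L : Type) [Field L] (α : Fin 3 → L)

/-- **`AgreesOnAdmissibleCoveredSlots L α jc′ jcH`** — the junction of the two systems of jump constants RESTRICTED TO ADMISSIBLE LABELS: for every `H`-chart `S` all of whose split places
are split-chart places of the frame (`∀ w′ ∈ S, w′ ∈ splitChartPlaces L α` — on the other labels `transfFam` and the genuine `G′`-families vanish identically, so no constant is read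
there) and every covered wall `w` of `S`, `jcH S w = 2 · jc′ S w 0 2` (the `(0, 2)` slot wall of the compact chart, doubled — PACK-SPEC §3).  Replaces ★ `AgreesOnCoveredSlots` in O-J∕O-L2
of the direct-road skeleton v2 (LHref-N box #1: on junk labels the unrestricted junction is refuted by L1 ∧ L3′). [cite: Shelstad1979, Thm. 4.7 (IIIb) (p. 31)]
[cite: Bouaziz1994IntegralesOrbitales, Rem. 2 p. 594] -/
def AgreesOnAdmissibleCoveredSlots (jc' : Finset {w : InfinitePlace L // IsComplex w} → {w : InfinitePlace L // IsComplex w} → Fin 3 → Fin 3 → ℂ)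
    (jcH : Finset {w : InfinitePlace L // IsComplex w} → {w : InfinitePlace L // IsComplex w} → ℂ) : Prop :=
  ∀ S w, (∀ w' ∈ S, w' ∈ splitChartPlaces L α) → IsCoveredWall (slotSign L α) S w → jcH S w = 2 * jc' S w 0 2

/-- Unfolding of `AgreesOnAdmissibleCoveredSlots`. [cite: Shelstad1979, Thm. 4.7 (IIIb) (p. 31)] -/
theorem agreesOnAdmissibleCoveredSlots_iff (jc' : Finset {w : InfinitePlace L // IsComplex w} → {w : InfinitePlace L // IsComplex w} → Fin 3 → Fin 3 → ℂ)
    (jcH : Finset {w : InfinitePlace L // IsComplex w} → {w : InfinitePlace L // IsComplex w} → ℂ) :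
    AgreesOnAdmissibleCoveredSlots L α jc' jcH ↔
      ∀ S w, (∀ w' ∈ S, w' ∈ splitChartPlaces L α) → IsCoveredWall (slotSign L α) S w → jcH S w = 2 * jc' S w 0 2 :=
  Iff.rfl

/-- The unrestricted junction implies the admissible one. [cite: Shelstad1979, Thm. 4.7 (IIIb) (p. 31)] -/
theorem AgreesOnCoveredSlots.agreesOnAdmissibleCoveredSlots
    {jc' : Finset {w : InfinitePlace L // IsComplex w} → {w : InfinitePlace L // IsComplex w} → Fin 3 → Fin 3 → ℂ}
    {jcH : Finset {w : InfinitePlace L // IsComplex w} → {w : InfinitePlace L // IsComplex w} → ℂ} (h : AgreesOnCoveredSlots L α jc' jcH) :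
    AgreesOnAdmissibleCoveredSlots L α jc' jcH :=
  fun S w _ hw => (agreesOnCoveredSlots_iff L α jc' jcH).1 h S w hw

/-- The predicted system `jcH S w := 2 · jc′ S w 0 2` agrees (on all labels, hence on the admissible ones): the junction is satisfiable for every `jc′`. [cite: Shelstad1979, Thm. 4.7 (IIIb) (p. 31)] -/
theorem agreesOnAdmissibleCoveredSlots_two_mul (jc' : Finset {w : InfinitePlace L // IsComplex w} → {w : InfinitePlace L // IsComplex w} → Fin 3 → Fin 3 → ℂ) :
    AgreesOnAdmissibleCoveredSlots L α jc' (fun S w => 2 * jc' S w 0 2) :=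
  fun _ _ _ _ => rfl

end Admissible

end Literature.NumberTheory.Rogawski1990

end
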